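import Summits.SmoothPoincare4.SmoothPoincare4.Theorems.SullivanDualTargetCroftonPencilDefs
import Summits.SmoothPoincare4.SmoothPoincare4.Theorems.SullivanDualWitnessChargeSubstubFar
import Summits.SmoothPoincare4.SmoothPoincare4.Theorems.SullivanDualWitnessChargeFlatChart

/-!
# Helper `helper_farIsLine` of line `crofton-pencil-laminar-charge`

Crux `SullivanDual.Target` (stmt-SmoothPoincare4-7823), skeleton
`Cruxes/Target/Lines/crofton_pencil_laminar_charge.lean`, wave 1 (stub `helper_farIsLine`).

**The far flat affine lines are lines.** Let `J` be standard on the punctured `ε'`-chart-ball at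
`p` (closed `ε'`-ball inside the chart target): `⟪Dψ (J v), c⟫ = ω₀(Dψ v, c)`, i.e.
`Dψ ∘ J = J₀ ∘ Dψ` for the flat coordinate map `ψ x = ι(e x − e p)`. For a chart `σ : Bool`, a
direction `a` and an intercept `b` with `ε'⁻¹ √(1 + ‖a‖²) < ‖b‖`, the curve whose complex flat
coordinates are exactly `Yc σ = (ξ, a ξ + b)` — i.e. `Ycoord = (ξ, a ξ + b)` for `σ = false` and
`Ycoord = (a ξ + b, ξ)` for `σ = true` — is a `J`-line of chart `σ`, direction `a`, intercept `b`
(`IsLine σ J u a b`), lying in the punctured `ε'`-chart-ball.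

Proof (the case `σ = false`, `a = 0` is `isPencilMember_farLine` of
`SullivanDualWitnessChargeSubstubFar.lean`, which we follow line by line). Both charts are treated
at once: the flat coordinates of the curve are `q ξ = L ξ + c` for a real-linear `L : ℂ → ℂ × ℂ`
(`ζ ↦ (ζ, a ζ)`, resp. `ζ ↦ (a ζ, ζ)`) and a constant `c` (`(0, b)`, resp. `(b, 0)`), and the
curve is `u ξ = χ (q ξ)` for the flat inverse chart `χ q = e.symm (e p + ι (realify q))` of
`SullivanDualWitnessChargeFlatChart.lean`. The whole affine line lies in the standard end:
`‖realify (q ξ)‖² = ‖ξ‖² + ‖a ξ + b‖² ≥ ‖b‖² / (1 + ‖a‖²) > ε'⁻²` (distance from the origin to the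
affine line: `‖b‖ ≤ ‖a ξ + b‖ + ‖a‖ ‖ξ‖ ≤ √(1 + ‖a‖²) √(‖ξ‖² + ‖a ξ + b‖²)`). Hence
(`flat_symm_mem_source`, `extChartAt_flat_symm`, `contMDiffOn_flat_symm`) `u` is `C^∞`, lies in the
punctured ball and has `Ycoord ∘ u = q`; the chain rule (`hasMFDerivAt_psi`) gives
`Dψ(u ξ) ∘ Du(ξ) = realify ∘ L`, so `u` is an injective immersion (`injective_Dpsi`,
`realify_injective`); standardness and `J₀ (realify (z, w)) = realify (i z, i w)` give
`Dψ (Du (i ζ)) = realify (L (i ζ)) = J₀ (realify (L ζ)) = Dψ (J (Du ζ))`, whence `J`-holomorphy;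
properness follows from `‖realify (q ξ)‖ ≥ ‖ξ‖` (a compact subset of `Σ ∖ p` misses a punctured
chart-ball `B_ρ`, and `u ξ ∈ B_ρ` once `‖ξ‖ > ρ⁻¹`); the asymptotics are exact equalities.
-/

noncomputable section

-- the prescribed namespace `Summit.<P>.<Sub>.…` duplicates `SmoothPoincare4` (P = Sub)
set_option linter.dupNamespace false

open scoped Manifold ContDiff Topology ENNReal NNReal
open Set Filter MeasureTheory Literature.Geometry.Kaehler Literature.Geometry.Symplectic
  Literature.Topology.FourManifolds
open Summit.SmoothPoincare4.SmoothPoincare4.Theorems.WitnessCharge.PencilIncompleteness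

namespace Summit.SmoothPoincare4.SmoothPoincare4.Theorems.Target.CroftonPencil

variable {S : HomotopySphere 4}

/-! ### Flat preliminaries -/

/-- In the complex flat coordinates the standard structure `J₀` is multiplication by `i` in both
factors: `J₀ (realify (z, w)) = realify (i z, i w)` (generalises `realify_I_mul`; pair form of
the sibling `J0_realify`). -/
theorem J0_realify_mk (z w : ℂ) :
    J0 (realify (z, w)) = realify (Complex.I * z, Complex.I * w) := by
  ext i; fin_cases i <;> simp [realify, J0]

/-- Distance from the origin to the affine line `w = a z + b`: for every `ξ`,
`‖b‖² ≤ (1 + ‖a‖²) (‖ξ‖² + ‖a ξ + b‖²)`. -/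
theorem norm_sq_le_affine (a b ξ : ℂ) :
    ‖b‖ ^ 2 ≤ (1 + ‖a‖ ^ 2) * (‖ξ‖ ^ 2 + ‖a * ξ + b‖ ^ 2) := by
  have h1 : ‖b‖ ≤ ‖a * ξ + b‖ + ‖a‖ * ‖ξ‖ := by
    calc ‖b‖ = ‖(a * ξ + b) - a * ξ‖ := by rw [add_sub_cancel_left]
      _ ≤ ‖a * ξ + b‖ + ‖a * ξ‖ := norm_sub_le _ _
      _ = ‖a * ξ + b‖ + ‖a‖ * ‖ξ‖ := by rw [norm_mul]
  have h2 : ‖b‖ ^ 2 ≤ (‖a * ξ + b‖ + ‖a‖ * ‖ξ‖) ^ 2 :=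
    pow_le_pow_left₀ (norm_nonneg b) h1 2
  nlinarith [sq_nonneg (‖a‖ * ‖a * ξ + b‖ - ‖ξ‖), h2]

/-- The far affine lines lie in the standard end: if `ε'⁻¹ √(1 + ‖a‖²) < ‖b‖` and
`r² = ‖ξ‖² + ‖a ξ + b‖²`, `r ≥ 0`, then `ε'⁻¹ < r`. -/
theorem inv_lt_of_far {ε' : ℝ} (hε' : 0 < ε') {a b : ℂ}
    (hb : ε'⁻¹ * Real.sqrt (1 + ‖a‖ ^ 2) < ‖b‖) (ξ : ℂ) {r : ℝ} (hr : 0 ≤ r)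
    (hrq : r ^ 2 = ‖ξ‖ ^ 2 + ‖a * ξ + b‖ ^ 2) : ε'⁻¹ < r := by
  have h0 : 0 < 1 + ‖a‖ ^ 2 := by positivity
  have h1 : (ε'⁻¹ * Real.sqrt (1 + ‖a‖ ^ 2)) ^ 2 < ‖b‖ ^ 2 :=
    pow_lt_pow_left₀ hb (mul_nonneg (inv_pos.2 hε').le (Real.sqrt_nonneg _)) two_ne_zero
  rw [mul_pow, Real.sq_sqrt h0.le] at h1
  have h2 : ε'⁻¹ ^ 2 * (1 + ‖a‖ ^ 2) < r ^ 2 * (1 + ‖a‖ ^ 2) := by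
    rw [hrq, mul_comm (‖ξ‖ ^ 2 + ‖a * ξ + b‖ ^ 2)]
    exact h1.trans_le (norm_sq_le_affine a b ξ)
  exact lt_of_pow_lt_pow_left₀ 2 hr (lt_of_mul_lt_mul_right h2 h0.le)

/-! ### Flat affine lines `ξ ↦ e.symm (e p + ι (realify (L ξ + c)))` inside the standard end -/

section AffLine

variable {p : S.carrier} {ε' : ℝ} (hε' : 0 < ε')
  (hball : Metric.closedBall (extChartAt (𝓡 4) p p) ε' ⊆ (extChartAt (𝓡 4) p).target)
  {L : ℂ →L[ℝ] ℂ × ℂ} {c : ℂ × ℂ} (hq : ∀ ξ : ℂ, ε'⁻¹ < ‖realify (L ξ + c)‖)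
  {u : ℂ → punctured p}
  (hu : ∀ ξ : ℂ, (u ξ).1 =
    (extChartAt (𝓡 4) p).symm (extChartAt (𝓡 4) p p + inversion (realify (L ξ + c))))
include hε' hball hq hu

/-- The affine line lies in the punctured `ε'`-chart-ball. -/
theorem affLine_mem_ball (ξ : ℂ) : InPuncturedChartBall p ε' (u ξ) := by
  refine ⟨?_, ?_⟩
  · rw [hu ξ]
    exact flat_symm_mem_source hε' hball (hq ξ)
  · rw [hu ξ, extChartAt_flat_symm hε' hball (hq ξ), Metric.mem_ball, dist_eq_norm,
      add_sub_cancel_left]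
    exact norm_inversion_realify_lt_of_lt hε' (hq ξ)

/-- The flat coordinate `ι(e (u ξ) − e p)` of the affine line is `realify (L ξ + c)`. -/
theorem inversion_affLine (ξ : ℂ) :
    inversion (extChartAt (𝓡 4) p (u ξ).1 - extChartAt (𝓡 4) p p) = realify (L ξ + c) := by
  rw [hu ξ, extChartAt_flat_symm hε' hball (hq ξ), add_sub_cancel_left, inversion_inversion]

/-- The complex flat coordinates of the affine line are `L ξ + c`. -/
theorem Ycoord_affLine (ξ : ℂ) : Ycoord p (u ξ) = L ξ + c := by
  apply realify_injective
  rw [realify_Ycoord, inversion_affLine hε' hball hq hu ξ]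

/-- The affine line is injective when `L` is. -/
theorem affLine_injective (hL : Function.Injective L) : Function.Injective u := by
  intro ξ ξ' h
  have h1 := congrArg (Ycoord p) h
  rw [Ycoord_affLine hε' hball hq hu ξ, Ycoord_affLine hε' hball hq hu ξ'] at h1
  exact hL (add_right_cancel h1)

/-- The affine line is `C^∞` as a map into the open submanifold `Σ ∖ p`. -/
theorem contMDiff_affLine : ContMDiff 𝓘(ℝ, ℂ) (𝓡 4) ∞ u := by
  have h1 : ContMDiff 𝓘(ℝ, ℂ) 𝓘(ℝ, ℂ × ℂ) ∞ (fun ξ : ℂ => L ξ + c) :=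
    (L.contDiff.add contDiff_const).contMDiff
  have h2 := (contMDiffOn_flat_symm hε' hball).comp_contMDiff h1 fun ξ => hq ξ
  have h3 : Subtype.val ∘ u =
      (fun q : ℂ × ℂ =>
          (extChartAt (𝓡 4) p).symm (extChartAt (𝓡 4) p p + inversion (realify q))) ∘
        fun ξ : ℂ => L ξ + c :=
    funext fun ξ => hu ξ
  rw [← ContMDiff.subtypeVal_comp_iff, h3]
  exact h2

/-- In flat coordinates the affine line is `ξ ↦ realify (L ξ + c)`:
`Dψ(u ξ) ∘ Du(ξ) = realify ∘ L`. -/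
theorem Dpsi_comp_mfderiv_affLine (ξ : ℂ) :
    ((fderiv ℝ inversion (extChartAt (𝓡 4) p (u ξ).1 - extChartAt (𝓡 4) p p)).comp
        (mfderiv (𝓡 4) 𝓘(ℝ, EuclideanSpace ℝ (Fin 4))
          (fun z : punctured p => extChartAt (𝓡 4) p z.1) (u ξ))).comp
      (mfderiv 𝓘(ℝ, ℂ) (𝓡 4) u ξ) = realifyL.comp L := by
  have hd : HasMFDerivAt 𝓘(ℝ, ℂ) (𝓡 4) u ξ (mfderiv 𝓘(ℝ, ℂ) (𝓡 4) u ξ) :=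
    ((contMDiff_affLine hε' hball hq hu).mdifferentiableAt (by simp)).hasMFDerivAt
  have h1 := (hasMFDerivAt_psi (affLine_mem_ball hε' hball hq hu ξ)).comp ξ hd
  have hfun : (fun z : punctured p =>
        inversion (extChartAt (𝓡 4) p z.1 - extChartAt (𝓡 4) p p)) ∘ u =
      fun ξ : ℂ => realifyL (L ξ + c) :=
    funext fun ξ => inversion_affLine hε' hball hq hu ξ
  rw [hfun] at h1
  have h2 : HasMFDerivAt 𝓘(ℝ, ℂ) 𝓘(ℝ, EuclideanSpace ℝ (Fin 4))
      (fun ξ : ℂ => realifyL (L ξ + c)) ξ (realifyL.comp L) := by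
    rw [hasMFDerivAt_iff_hasFDerivAt]
    exact realifyL.hasFDerivAt.comp ξ (L.hasFDerivAt.add_const c)
  exact hasMFDerivAt_unique h1 h2

/-- Consequence: `Dψ(u ξ) (Du(ξ) ζ) = realify (L ζ)`. -/
theorem Dpsi_mfderiv_affLine_apply (ξ ζ : ℂ) :
    fderiv ℝ inversion (extChartAt (𝓡 4) p (u ξ).1 - extChartAt (𝓡 4) p p)
        (mfderiv (𝓡 4) 𝓘(ℝ, EuclideanSpace ℝ (Fin 4))
          (fun z : punctured p => extChartAt (𝓡 4) p z.1) (u ξ)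
          (mfderiv 𝓘(ℝ, ℂ) (𝓡 4) u ξ ζ)) = realify (L ζ) := by
  have h := ContinuousLinearMap.ext_iff.1 (Dpsi_comp_mfderiv_affLine hε' hball hq hu ξ) ζ
  simp only [ContinuousLinearMap.comp_apply] at h
  exact h

/-- The affine line is an immersion when `L` is injective. -/
theorem injective_mfderiv_affLine (hL : Function.Injective L) (ξ : ℂ) :
    Function.Injective (mfderiv 𝓘(ℝ, ℂ) (𝓡 4) u ξ) := by
  intro ζ ζ' h
  have h1 := Dpsi_mfderiv_affLine_apply hε' hball hq hu ξ ζ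
  have h2 := Dpsi_mfderiv_affLine_apply hε' hball hq hu ξ ζ'
  rw [h] at h1
  exact hL (realify_injective (h1.symm.trans h2))

/-- For `J` standard on the punctured `ε'`-chart-ball (`⟪Dψ (J v), c⟫ = ω₀(Dψ v, c)`) and `L`
complex-linear in realified form (`realify (L (i ζ)) = J₀ (realify (L ζ))`), the affine line is
`J`-holomorphic: `Dψ` maps both `Du (i ζ)` and `J (Du ζ)` to `J₀ (realify (L ζ))`. -/
theorem isJHolomorphic_affLine
    (J : ∀ x : punctured p, TangentSpace (𝓡 4) x →L[ℝ] TangentSpace (𝓡 4) x)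
    (hJstd : ∀ x : punctured p, InPuncturedChartBall p ε' x →
      ∀ (v : TangentSpace (𝓡 4) x) (b : EuclideanSpace ℝ (Fin 4)),
        inner ℝ (fderiv ℝ inversion (extChartAt (𝓡 4) p x.1 - extChartAt (𝓡 4) p p)
          (mfderiv (𝓡 4) 𝓘(ℝ, EuclideanSpace ℝ (Fin 4))
            (fun z : punctured p => extChartAt (𝓡 4) p z.1) x (J x v))) b
        = stdSymplecticForm (fderiv ℝ inversion (extChartAt (𝓡 4) p x.1 - extChartAt (𝓡 4) p p)
          (mfderiv (𝓡 4) 𝓘(ℝ, EuclideanSpace ℝ (Fin 4))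
            (fun z : punctured p => extChartAt (𝓡 4) p z.1) x v)) b)
    (hLI : ∀ ζ : ℂ, realify (L (Complex.I * ζ)) = J0 (realify (L ζ))) :
    IsJHolomorphic (𝓡 4) J u := by
  intro ξ ζ
  have hx : InPuncturedChartBall p ε' (u ξ) := affLine_mem_ball hε' hball hq hu ξ
  apply injective_Dpsi hx
  simp only [ContinuousLinearMap.comp_apply]
  have h1 := Dpsi_mfderiv_affLine_apply hε' hball hq hu ξ (Complex.I * ζ)
  have h2 := Dpsi_mfderiv_affLine_apply hε' hball hq hu ξ ζ
  -- standardness: `Dψ (J v) = J₀ (Dψ v)` for `v = Du ζ`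
  have h3 : fderiv ℝ inversion (extChartAt (𝓡 4) p (u ξ).1 - extChartAt (𝓡 4) p p)
        (mfderiv (𝓡 4) 𝓘(ℝ, EuclideanSpace ℝ (Fin 4))
          (fun z : punctured p => extChartAt (𝓡 4) p z.1) (u ξ)
          (J (u ξ) (mfderiv 𝓘(ℝ, ℂ) (𝓡 4) u ξ ζ))) = J0 (realify (L ζ)) := by
    apply eq_of_inner_eq
    intro c'
    rw [hJstd _ hx _ c', inner_J0, h2]
  exact h1.trans ((hLI ζ).trans h3.symm)

/-- The affine line is proper, provided `‖ξ‖ ≤ ‖realify (L ξ + c)‖`: a compact subset of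
`Σ ∖ p` misses a punctured chart-ball `B_ρ`, while `u ξ ∈ B_ρ` as soon as `‖ξ‖ > ρ⁻¹`. -/
theorem isCompact_preimage_affLine (hn : ∀ ξ : ℂ, ‖ξ‖ ≤ ‖realify (L ξ + c)‖)
    {K : Set (punctured p)} (hK : IsCompact K) : IsCompact (u ⁻¹' K) := by
  obtain ⟨ρ, hρ, hρK⟩ := exists_ball_disjoint_of_isCompact hK
  have hclosed : IsClosed (u ⁻¹' K) :=
    hK.isClosed.preimage (contMDiff_affLine hε' hball hq hu).continuous
  refine (isCompact_closedBall (0 : ℂ) ρ⁻¹).of_isClosed_subset hclosed fun ξ hξ => ?_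
  rw [Metric.mem_closedBall, dist_zero_right]
  refine le_of_not_gt fun hlt => ?_
  apply hρK (u ξ) _ hξ
  refine ⟨(affLine_mem_ball hε' hball hq hu ξ).1, ?_⟩
  rw [hu ξ, extChartAt_flat_symm hε' hball (hq ξ), Metric.mem_ball, dist_eq_norm,
    add_sub_cancel_left, norm_inversion]
  have hξ' : ρ⁻¹ < ‖realify (L ξ + c)‖ := hlt.trans_le (hn ξ)
  have hpos : 0 < ‖realify (L ξ + c)‖ := (inv_pos.2 hρ).trans hξ'
  exact (inv_lt_comm₀ hpos hρ).2 hξ'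

/-- Assembly: for `J` standard on the punctured `ε'`-chart-ball, an affine line with `L` injective
and complex-linear in realified form, `‖ξ‖ ≤ ‖realify (L ξ + c)‖`, and complex flat coordinates
`Yc σ = (ξ, a ξ + b)`, is a `J`-line of chart `σ`, direction `a`, intercept `b`. -/
theorem isLine_affLine
    (J : ∀ x : punctured p, TangentSpace (𝓡 4) x →L[ℝ] TangentSpace (𝓡 4) x)
    (hJstd : ∀ x : punctured p, InPuncturedChartBall p ε' x →
      ∀ (v : TangentSpace (𝓡 4) x) (b : EuclideanSpace ℝ (Fin 4)),
        inner ℝ (fderiv ℝ inversion (extChartAt (𝓡 4) p x.1 - extChartAt (𝓡 4) p p)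
          (mfderiv (𝓡 4) 𝓘(ℝ, EuclideanSpace ℝ (Fin 4))
            (fun z : punctured p => extChartAt (𝓡 4) p z.1) x (J x v))) b
        = stdSymplecticForm (fderiv ℝ inversion (extChartAt (𝓡 4) p x.1 - extChartAt (𝓡 4) p p)
          (mfderiv (𝓡 4) 𝓘(ℝ, EuclideanSpace ℝ (Fin 4))
            (fun z : punctured p => extChartAt (𝓡 4) p z.1) x v)) b)
    (hL : Function.Injective L)
    (hLI : ∀ ζ : ℂ, realify (L (Complex.I * ζ)) = J0 (realify (L ζ)))
    (hn : ∀ ξ : ℂ, ‖ξ‖ ≤ ‖realify (L ξ + c)‖)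
    {σ : Bool} {a b : ℂ} (hYc : ∀ ξ : ℂ, Yc σ p (u ξ) = (ξ, a * ξ + b)) :
    IsLine σ J u a b := by
  refine ⟨⟨contMDiff_affLine hε' hball hq hu, ⟨0, 1, fun h => ?_⟩,
      isJHolomorphic_affLine hε' hball hq hu J hJstd hLI⟩, affLine_injective hε' hball hq hu hL,
    injective_mfderiv_affLine hε' hball hq hu hL,
    fun K hK => isCompact_preimage_affLine hε' hball hq hu hn hK, ?_, ?_⟩
  · exact zero_ne_one (affLine_injective hε' hball hq hu hL h)
  · simp only [hYc, sub_self]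
    exact tendsto_const_nhds
  · simp only [hYc, add_sub_cancel_left]
    exact tendsto_const_nhds

end AffLine

/-! ### The registered helper -/

/-- **Registered helper `helper_farIsLine`: the far flat affine lines are lines.** For `J`
standard on the punctured `ε'`-chart-ball at `p` (closed `ε'`-ball inside the chart target), every
chart `σ`, direction `a` and intercept `b` with `ε'⁻¹ √(1 + ‖a‖²) < ‖b‖ (so that the whole affine
line lies in the flat region), the curve with complex flat coordinates exactly `Yc σ = (ξ, a ξ + b)`
is a `J`-line of chart `σ` with direction `a` and intercept `b`, contained in the punctured
`ε'`-chart-ball. -/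
theorem helper_farIsLine :
    ∀ (S : HomotopySphere 4) (p : S.carrier)
      (J : ∀ x : punctured p, TangentSpace (𝓡 4) x →L[ℝ] TangentSpace (𝓡 4) x) (ε' : ℝ),
      0 < ε' →
      Metric.closedBall (extChartAt (𝓡 4) p p) ε' ⊆ (extChartAt (𝓡 4) p).target →
      (∀ x : punctured p, InPuncturedChartBall p ε' x →
        ∀ (v : TangentSpace (𝓡 4) x) (b : EuclideanSpace ℝ (Fin 4)),
          inner ℝ (fderiv ℝ inversion (extChartAt (𝓡 4) p x.1 - extChartAt (𝓡 4) p p)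
            (mfderiv (𝓡 4) 𝓘(ℝ, EuclideanSpace ℝ (Fin 4))
              (fun z : punctured p => extChartAt (𝓡 4) p z.1) x (J x v))) b
          = stdSymplecticForm (fderiv ℝ inversion (extChartAt (𝓡 4) p x.1 - extChartAt (𝓡 4) p p)
            (mfderiv (𝓡 4) 𝓘(ℝ, EuclideanSpace ℝ (Fin 4))
              (fun z : punctured p => extChartAt (𝓡 4) p z.1) x v)) b) →
      ∀ (σ : Bool) (a b : ℂ), ε'⁻¹ * Real.sqrt (1 + ‖a‖ ^ 2) < ‖b‖ →
        ∃ u : ℂ → punctured p, IsLine σ J u a b ∧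
          ∀ ξ : ℂ, InPuncturedChartBall p ε' (u ξ) ∧ Yc σ p (u ξ) = (ξ, a * ξ + b) := by
  intro S p J ε' hε' hball hJstd σ a b hb
  -- the flat inverse chart `χ q = e.symm (e p + ι (realify q))` on the standard end
  obtain ⟨χ, hχ⟩ := exists_flatInv hε' hball
  -- the flat data `q ξ = L ξ + c` of chart `σ`: `(ξ, a ξ + b)`, resp. `(a ξ + b, ξ)`
  obtain ⟨L, c, hnr, hL, hLI, hYc'⟩ : ∃ (L : ℂ →L[ℝ] ℂ × ℂ) (c : ℂ × ℂ),
      (∀ ξ : ℂ, ‖realify (L ξ + c)‖ ^ 2 = ‖ξ‖ ^ 2 + ‖a * ξ + b‖ ^ 2) ∧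
      Function.Injective L ∧
      (∀ ζ : ℂ, realify (L (Complex.I * ζ)) = J0 (realify (L ζ))) ∧
      ∀ (x : punctured p) (ξ : ℂ), Ycoord p x = L ξ + c → Yc σ p x = (ξ, a * ξ + b) := by
    cases σ with
    | false =>
      have hLa : ∀ ζ : ℂ,
          ((ContinuousLinearMap.id ℝ ℂ).prod (a • ContinuousLinearMap.id ℝ ℂ)) ζ = (ζ, a * ζ) :=
        fun ζ => rfl
      have hLc : ∀ ξ : ℂ,
          ((ContinuousLinearMap.id ℝ ℂ).prod (a • ContinuousLinearMap.id ℝ ℂ)) ξ + (0, b) =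
            (ξ, a * ξ + b) := fun ξ => by
        rw [hLa, Prod.mk_add_mk, add_zero]
      refine ⟨(ContinuousLinearMap.id ℝ ℂ).prod (a • ContinuousLinearMap.id ℝ ℂ), (0, b),
        fun ξ => ?_, fun ζ ζ' h => ?_, fun ζ => ?_, fun x ξ hx => ?_⟩
      · rw [hLc]
        exact norm_realify_sq (ξ, a * ξ + b)
      · rw [hLa, hLa] at h
        exact congrArg Prod.fst h
      · rw [hLa (Complex.I * ζ), hLa ζ, J0_realify_mk, mul_left_comm]
      · rw [Yc, if_neg Bool.false_ne_true, hx, hLc]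
    | true =>
      have hLa : ∀ ζ : ℂ,
          ((a • ContinuousLinearMap.id ℝ ℂ).prod (ContinuousLinearMap.id ℝ ℂ)) ζ = (a * ζ, ζ) :=
        fun ζ => rfl
      have hLc : ∀ ξ : ℂ,
          ((a • ContinuousLinearMap.id ℝ ℂ).prod (ContinuousLinearMap.id ℝ ℂ)) ξ + (b, 0) =
            (a * ξ + b, ξ) := fun ξ => by
        rw [hLa, Prod.mk_add_mk, add_zero]
      refine ⟨(a • ContinuousLinearMap.id ℝ ℂ).prod (ContinuousLinearMap.id ℝ ℂ), (b, 0),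
        fun ξ => ?_, fun ζ ζ' h => ?_, fun ζ => ?_, fun x ξ hx => ?_⟩
      · rw [hLc]
        exact (norm_realify_sq (a * ξ + b, ξ)).trans (add_comm _ _)
      · rw [hLa, hLa] at h
        exact congrArg Prod.snd h
      · rw [hLa (Complex.I * ζ), hLa ζ, J0_realify_mk, mul_left_comm]
      · rw [Yc, if_pos rfl, hx, hLc]
  -- the whole affine line lies in the standard end
  have hq : ∀ ξ : ℂ, ε'⁻¹ < ‖realify (L ξ + c)‖ := fun ξ =>
    inv_lt_of_far hε' hb ξ (norm_nonneg _) (hnr ξ)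
  have hu : ∀ ξ : ℂ, (χ (L ξ + c)).1 = (extChartAt (𝓡 4) p).symm
      (extChartAt (𝓡 4) p p + inversion (realify (L ξ + c))) := fun ξ => hχ _ (hq ξ)
  have hn : ∀ ξ : ℂ, ‖ξ‖ ≤ ‖realify (L ξ + c)‖ := fun ξ => by
    refine le_of_pow_le_pow_left₀ two_ne_zero (norm_nonneg _) ?_
    rw [hnr ξ]
    exact le_add_of_nonneg_right (sq_nonneg _)
  have hYc : ∀ ξ : ℂ, Yc σ p (χ (L ξ + c)) = (ξ, a * ξ + b) := fun ξ =>
    hYc' _ ξ (Ycoord_affLine hε' hball hq hu ξ)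
  exact ⟨fun ξ => χ (L ξ + c), isLine_affLine hε' hball hq hu J hJstd hL hLI hn hYc,
    fun ξ => ⟨affLine_mem_ball hε' hball hq hu ξ, hYc ξ⟩⟩

end Summit.SmoothPoincare4.SmoothPoincare4.Theorems.Target.CroftonPencil

end
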